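import Summits.AnomalousDissipation.AnomalousDissipation.Theses.EulerLimit
import Literature.Barriers.AnomalousDissipation.IntermittentDissipationCompactness

/-!
# Stub-ideation k3 — typed helper lemmas for `stub_kolmogorovRieszPeriodicSlab` (companion of `STUB-IDEAS-stub_kolmogorovRieszPeriodicSlab-3.md`)

Plan A ("perturb the proved neighbour"): the stub is
`Literature.Barriers.AnomalousDissipation.DeRosaIsett2024_s61_compactness_holds` with its two
PDE-specific inputs replaced by the two AXIS SLICES of the Kolmogorov–Riesz modulus:
time slice (`h = 0`) replaces "increments from the NS equations" (H1–H3), space slice (`s = 0`)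
replaces "Besov bound + CET (6)" (H4–H5); H6 = Steps 3–5 of the discharge verbatim; H7 = periodisation.
All `sorry`s below are the helper lemmas (one prover cycle each); nothing here is registered.
-/

noncomputable section

open MeasureTheory TopologicalSpace Set Function Filter Metric UnitAddTorus
open scoped ENNReal NNReal Convolution Topology

namespace Summit.AnomalousDissipation.AnomalousDissipation.Cruxes.EulerlimitThesisV2.Tight.Ideas3

open Literature.Analysis.FunctionSpaces Literature.Analysis.FunctionSpaces.Torus

/-! ## H1 — `L³(0,T)` bound from cell averages and an integral modulus of continuity
(analogue of `lintegral_enorm_pow_three_le_of_increments`, Hanche-Olsen–Holden 2010, proof of Thm 5) -/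

theorem lintegral_enorm_pow_three_le_of_modulus
    {E : Type*} [NormedAddCommGroup E] [NormedSpace ℝ E] [CompleteSpace E]
    {T : ℝ} (hT : 0 < T) {F : ℝ → E} (hF : Continuous F) (L : ℕ) {Λ : ℝ≥0∞}
    (hmod : ∀ σ : ℝ, |σ| ≤ T / (L + 1) → ∫⁻ t in Ioo 0 T, ‖F (t + σ) - F t‖ₑ ^ 3 ≤ Λ) :
    ∫⁻ t in Ioo 0 T, ‖F t‖ₑ ^ 3 ≤
      4 * ENNReal.ofReal ((L + 1 : ℝ) / T) ^ 2 *
          ∑ l ∈ Finset.range (L + 1),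
            ‖∫ t in Ioo ((l : ℝ) * (T / (L + 1))) ((l + 1 : ℝ) * (T / (L + 1))), F t‖ₑ ^ 3 +
        8 * Λ := by
  sorry

/-! ## H2 — `L³(0,T)` Cauchy from a uniform modulus and convergent cell averages
(analogue of `exists_forall_lintegral_enorm_sub_pow_three_le_of_increments`) -/

theorem exists_forall_lintegral_enorm_sub_pow_three_le_of_modulus
    {E : Type*} [NormedAddCommGroup E] [NormedSpace ℝ E] [CompleteSpace E]
    {T : ℝ} (hT : 0 < T) {F : ℕ → ℝ → E} (hF : ∀ n, Continuous (F n))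
    (hmod : ∀ Λ : ℝ≥0∞, 0 < Λ → ∃ δ : ℝ, 0 < δ ∧ ∀ (n : ℕ) (σ : ℝ), |σ| ≤ δ →
      ∫⁻ t in Ioo 0 T, ‖F n (t + σ) - F n t‖ₑ ^ 3 ≤ Λ)
    (havg : ∀ L l : ℕ, l ≤ L → ∃ c : E, Tendsto
      (fun n => ∫ t in Ioo ((l : ℝ) * (T / (L + 1))) ((l + 1 : ℝ) * (T / (L + 1))), F n t)
        atTop (𝓝 c))
    {η : ℝ≥0∞} (hη : 0 < η) :
    ∃ N : ℕ, ∀ n m : ℕ, N ≤ n → N ≤ m → ∫⁻ t in Ioo 0 T, ‖F n t - F m t‖ₑ ^ 3 ≤ η := by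
  sorry

/-! ## H3 — a subsequence with every Fourier mode Cauchy in `L³(0,T)`, from the TIME modulus
(copy-edit of `Literature.Analysis.FluidPDE.exists_subseq_forall_modes_cauchy_L3`) -/

theorem exists_subseq_forall_modes_cauchy_L3_of_modulus
    {d : Type*} [Fintype d] {T : ℝ} (hT : 0 < T)
    {u : ℕ → ℝ → UnitAddTorus d → EuclideanSpace ℝ d}
    (hu : ∀ j, IsSmoothSpaceTimeOn univ (u j))
    {B : ℝ≥0∞} (hB : B ≠ ⊤) (hL3 : ∀ j, ∫⁻ t in Ioo 0 T, ∫⁻ x, ‖u j t x‖ₑ ^ 3 ≤ B)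
    (hmod : ∀ Λ : ℝ≥0∞, 0 < Λ → ∃ δ : ℝ, 0 < δ ∧ ∀ (j : ℕ) (σ : ℝ), |σ| ≤ δ →
      ∫⁻ t in Ioo 0 T, ∫⁻ x, ‖u j (t + σ) x - u j t x‖ₑ ^ 3 ≤ Λ) :
    ∃ φ : ℕ → ℕ, StrictMono φ ∧ ∀ (k : d → ℤ) (η : ℝ≥0∞), 0 < η → ∃ N : ℕ, ∀ n m : ℕ,
      N ≤ n → N ≤ m →
        ∫⁻ t in Ioo 0 T, ‖mFourierCoeff (EuclideanSpace.complexify ∘ u (φ n) t) k -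
          mFourierCoeff (EuclideanSpace.complexify ∘ u (φ m) t) k‖ₑ ^ 3 ≤ η := by
  sorry

/-! ## H4 — time-integrated CET (6): mollification error ≤ SPACE modulus
(`kernel_convolution_sub_self_apply` + `lintegral_rpow_enorm_integral_smul_le` on `X = (0,T) × T^d`) -/

theorem lintegral_lintegral_kernel_convolution_sub_self_le
    {d : Type*} [Fintype d] {T : ℝ} {w : ℝ → UnitAddTorus d → EuclideanSpace ℝ d}
    (hw : AEStronglyMeasurable (uncurry w) ((volume.restrict (Ioo 0 T)).prod volume))
    (hwi : ∀ t ∈ Ioo 0 T, Integrable (w t) volume)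
    {ε : ℝ} (hε : 0 < ε) (hε' : ε ≤ 1 / 4) {Λ : ℝ≥0∞}
    (hmod : ∀ y : UnitAddTorus d, ‖y‖ ≤ ε →
      ∫⁻ t in Ioo 0 T, ∫⁻ x, ‖w t (x - y) - w t x‖ₑ ^ 3 ≤ Λ) :
    ∫⁻ t in Ioo 0 T, ∫⁻ x, ‖(kernel ε ⋆ w t) x - w t x‖ₑ ^ 3 ≤ Λ := by
  sorry

/-! ## H5 — `L³((0,T) × T^d)` Cauchy: uniform mollification error in space, Cauchy modes in time
(copy-edit of `Torus.exists_forall_lintegral_sub_pow_three_le_of_modes`: `hθ`/`hwB` ↦ `hwB` + `hmoll`) -/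

theorem exists_forall_lintegral_sub_pow_three_le_of_modes_of_mollify
    {d : Type*} [Fintype d] [DecidableEq d] {T : ℝ} (hT : 0 < T)
    {w : ℕ → ℝ → UnitAddTorus d → EuclideanSpace ℝ d}
    (hw : ∀ n, IsSmoothSpaceTimeOn (Ioo 0 T) (w n))
    {B : ℝ≥0∞} (hB : B ≠ ⊤)
    (hwB : ∀ n, ∫⁻ t in Ioo 0 T, ∫⁻ x, ‖w n t x‖ₑ ^ 3 ≤ B)
    (hmoll : ∀ ρ : ℝ≥0∞, 0 < ρ → ∃ ε : ℝ, 0 < ε ∧ ε ≤ 1 / 4 ∧ ∀ n,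
      ∫⁻ t in Ioo 0 T, ∫⁻ x, ‖(kernel ε ⋆ w n t) x - w n t x‖ₑ ^ 3 ≤ ρ)
    (hmode : ∀ k : d → ℤ, ∀ η : ℝ≥0∞, 0 < η → ∃ N : ℕ, ∀ n m : ℕ, N ≤ n → N ≤ m →
      ∫⁻ t in Ioo 0 T, ‖mFourierCoeff (EuclideanSpace.complexify ∘ w n t) k -
        mFourierCoeff (EuclideanSpace.complexify ∘ w m t) k‖ₑ ^ 3 ≤ η)
    {η : ℝ≥0∞} (hη : 0 < η) :
    ∃ N : ℕ, ∀ n m : ℕ, N ≤ n → N ≤ m →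
      ∫⁻ t in Ioo 0 T, ∫⁻ x, ‖w n t x - w m t x‖ₑ ^ 3 ≤ η := by
  sorry

/-! ## H6 — strong `L³((0,T) × T^d)` limit of a Cauchy family (Steps 3–5 of
`DeRosaIsett2024_s61_compactness_holds`: `exists_fast_subseq` + `Lp.cauchy_complete_eLpNorm`) -/

theorem exists_subseq_tendsto_of_cauchy_L3
    {d : Type*} [Fintype d] {T : ℝ}
    {W : ℕ → ℝ → UnitAddTorus d → EuclideanSpace ℝ d}
    (hWm : ∀ n, AEStronglyMeasurable (uncurry (W n)) ((volume.restrict (Ioo 0 T)).prod volume))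
    {B : ℝ≥0∞} (hB : B ≠ ⊤) (hWB : ∀ n, ∫⁻ t in Ioo 0 T, ∫⁻ x, ‖W n t x‖ₑ ^ 3 ≤ B)
    (hcau : ∀ η : ℝ≥0∞, 0 < η → ∃ N : ℕ, ∀ n m : ℕ, N ≤ n → N ≤ m →
      ∫⁻ t in Ioo 0 T, ∫⁻ x, ‖W n t x - W m t x‖ₑ ^ 3 ≤ η) :
    ∃ (ψ : ℕ → ℕ) (V : ℝ → UnitAddTorus d → EuclideanSpace ℝ d), StrictMono ψ ∧
      AEStronglyMeasurable (uncurry V) ((volume.restrict (Ioo 0 T)).prod volume) ∧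
      Tendsto (fun n => ∫⁻ t in Ioo 0 T, ∫⁻ x, ‖W (ψ n) t x - V t x‖ₑ ^ 3) atTop (𝓝 0) := by
  sorry

/-! ## H7 — periodisation of the limit (`w t := V (toIcoMod hτ 0 t)`) -/

theorem exists_periodic_extension
    {d : Type*} [Fintype d] {F : Type*} [TopologicalSpace F]
    {τ : ℝ} (hτ : 0 < τ) (V : ℝ → UnitAddTorus d → F)
    (hV : AEStronglyMeasurable (uncurry V) ((volume.restrict (Ioo 0 τ)).prod volume)) :
    ∃ w : ℝ → UnitAddTorus d → F, Function.Periodic w τ ∧ (∀ t ∈ Ioo 0 τ, w t = V t) ∧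
      AEStronglyMeasurable (stLift w) (volume.restrict (Ioo 0 τ ×ˢ univ)) := by
  sorry

/-! ## Plan B helpers — JOINT-modulus box averages on the compact group (no Fourier side)

`boxAvg δ v (t,x) = ∫ χ_δ(s) • (ρ_δ ⋆ v(t+s))(x) ds` with Mathlib's normalised bump `χ_δ`
(`ContDiffBump.normed`, support `⊆ (-δ, δ)`, unit mass) and the tree's torus kernel `ρ_δ = kernel δ`. -/

/-- The time bump of radius `δ` (inner radius `δ/2`). -/
def timeBump {δ : ℝ} (hδ : 0 < δ) : ContDiffBump (0 : ℝ) := ⟨δ / 2, δ, half_pos hδ, half_lt_self hδ⟩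

/-- Space–time box average of a field at scale `δ`. -/
def boxAvg {d : Type*} [Fintype d] {δ : ℝ} (hδ : 0 < δ) (v : ℝ → UnitAddTorus d → EuclideanSpace ℝ d)
    (t : ℝ) (x : UnitAddTorus d) : EuclideanSpace ℝ d :=
  ∫ s, (timeBump hδ).normed volume s • (kernel δ ⋆ v (t + s)) x

/-- B1 — approximation by box averages is controlled by the JOINT modulus (Minkowski–Jensen on
`X = (0,T) × T^d`, `Y = ℝ × T^d`, weight `χ_δ ⊗ ρ_δ`). -/
theorem lintegral_lintegral_boxAvg_sub_self_le
    {d : Type*} [Fintype d] {T δ : ℝ} (hδ : 0 < δ) (hδ' : δ ≤ 1 / 4)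
    {v : ℝ → UnitAddTorus d → EuclideanSpace ℝ d} (hv : IsSmoothSpaceTimeOn univ v) {Λ : ℝ≥0∞}
    (hmod : ∀ (s : ℝ) (h : UnitAddTorus d), |s| ≤ δ → ‖h‖ ≤ δ →
      ∫⁻ t in Ioo 0 T, ∫⁻ x, ‖v (t + s) (x - h) - v t x‖ₑ ^ 3 ≤ Λ) :
    ∫⁻ t in Ioo 0 T, ∫⁻ x, ‖boxAvg hδ v t x - v t x‖ₑ ^ 3 ≤ Λ := by
  sorry

/-- B2 — box averages of a bounded periodic family are equibounded and equi-Lipschitz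
(constants depend on `δ, τ, M` only; periodicity bounds the mass on the window `(-δ, τ + δ)`). -/
theorem exists_boxAvg_bound_lipschitz
    {d : Type*} [Fintype d] {τ δ : ℝ} (hτ : 0 < τ) (hδ : 0 < δ) (hδ' : δ ≤ 1 / 4) (M : ℝ) :
    ∃ C : ℝ, ∀ v : ℝ → UnitAddTorus d → EuclideanSpace ℝ d, IsSmoothSpaceTimeOn univ v →
      Function.Periodic v τ → (∫⁻ t in Ioo 0 τ, ∫⁻ x, ‖v t x‖ₑ ^ 3 ≤ ENNReal.ofReal M) →
      (∀ t x, ‖boxAvg hδ v t x‖ ≤ C) ∧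
        ∀ t t' x x', ‖boxAvg hδ v t x - boxAvg hδ v t' x'‖ ≤ C * (|t - t'| + ‖x - x'‖) := by
  sorry

/-- B3 — diagonal extraction: along one subsequence, the box averages at every scale
`δ_m = 1/(m+4)` are uniformly Cauchy on `[0,τ] × T^d` (finite grids + equi-Lipschitz +
`exists_strictMono_forall_tendsto`; or Mathlib's Arzelà–Ascoli). -/
theorem exists_subseq_boxAvg_uniformly_cauchy
    {d : Type*} [Fintype d] {τ : ℝ} (hτ : 0 < τ)
    {v : ℕ → ℝ → UnitAddTorus d → EuclideanSpace ℝ d}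
    (hbd : ∀ m : ℕ, ∃ C : ℝ, ∀ j,
      (∀ t x, ‖boxAvg (δ := 1 / ((m : ℝ) + 4)) (by positivity) (v j) t x‖ ≤ C) ∧
      ∀ t t' x x', ‖boxAvg (δ := 1 / ((m : ℝ) + 4)) (by positivity) (v j) t x -
        boxAvg (δ := 1 / ((m : ℝ) + 4)) (by positivity) (v j) t' x'‖ ≤ C * (|t - t'| + ‖x - x'‖)) :
    ∃ φ : ℕ → ℕ, StrictMono φ ∧ ∀ (m : ℕ) (η : ℝ), 0 < η → ∃ N : ℕ, ∀ n n' : ℕ, N ≤ n → N ≤ n' →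
      ∀ t ∈ Icc 0 τ, ∀ x,
        ‖boxAvg (δ := 1 / ((m : ℝ) + 4)) (by positivity) (v (φ n)) t x -
          boxAvg (δ := 1 / ((m : ℝ) + 4)) (by positivity) (v (φ n')) t x‖ ≤ η := by
  sorry

/-! ## Assembly — the stub from H3–H7 (H1, H2 feed H3); typed and kernel-checked modulo the
helper `sorry`s.  `𝕋³ = UnitAddTorus (Fin 3)`, `E³ = EuclideanSpace ℝ (Fin 3)`. -/

/-- The physical flat unit torus `𝕋³` (local notation). -/
local notation "𝕋³" => UnitAddTorus (Fin 3)
/-- Velocity values (local notation). -/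
local notation "E³" => EuclideanSpace ℝ (Fin 3)

theorem stub_kolmogorovRieszPeriodicSlab_of_helpers :
    ∀ (τ M : ℝ) (v : ℕ → ℝ → 𝕋³ → E³), 0 < τ →
      (∀ j, IsSmoothSpaceTimeOn Set.univ (v j)) →
      (∀ j, Function.Periodic (v j) τ) →
      (∀ j, ∫⁻ t in Set.Ioo 0 τ, ∫⁻ x, ‖v j t x‖ₑ ^ 3 ≤ ENNReal.ofReal M) →
      (∀ ε : ℝ, 0 < ε → ∃ δ : ℝ, 0 < δ ∧ ∀ (j : ℕ) (s : ℝ) (h : 𝕋³), |s| ≤ δ → ‖h‖ ≤ δ →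
        ∫⁻ t in Set.Ioo 0 τ, ∫⁻ x, ‖v j (t + s) (x + h) - v j t x‖ₑ ^ 3 ≤ ENNReal.ofReal ε) →
      ∃ (w : ℝ → 𝕋³ → E³) (φ : ℕ → ℕ), StrictMono φ ∧ Function.Periodic w τ ∧
        AEStronglyMeasurable (stLift w) (volume.restrict (Set.Ioo 0 τ ×ˢ Set.univ)) ∧
        Tendsto (fun j => ∫⁻ t in Set.Ioo 0 τ, ∫⁻ x, ‖v (φ j) t x - w t x‖ₑ ^ 3)
          atTop (𝓝 0) := by
  intro τ M v hτ hsm _hper hM hKR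
  -- Step 0: the bound and the two AXIS SLICES of the modulus, in `ℝ≥0∞` form
  have hB : ENNReal.ofReal M ≠ ⊤ := ENNReal.ofReal_ne_top
  have hsm' : ∀ j, IsSmoothSpaceTimeOn (Ioo 0 τ) (v j) := fun j => (hsm j).mono (subset_univ _)
  have hmodT : ∀ Λ : ℝ≥0∞, 0 < Λ → ∃ δ : ℝ, 0 < δ ∧ ∀ (j : ℕ) (σ : ℝ), |σ| ≤ δ →
      ∫⁻ t in Ioo 0 τ, ∫⁻ x, ‖v j (t + σ) x - v j t x‖ₑ ^ 3 ≤ Λ := by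
    intro Λ hΛ
    rcases eq_or_ne Λ ⊤ with hΛt | hΛt
    · exact ⟨1, one_pos, fun j σ _ => hΛt ▸ le_top⟩
    obtain ⟨δ, hδ, hδ'⟩ := hKR Λ.toReal (ENNReal.toReal_pos hΛ.ne' hΛt)
    refine ⟨δ, hδ, fun j σ hσ => ?_⟩
    have h := hδ' j σ 0 hσ (by simpa using hδ.le)
    simpa only [add_zero, ENNReal.ofReal_toReal hΛt] using h
  have hmodX : ∀ Λ : ℝ≥0∞, 0 < Λ → ∃ δ : ℝ, 0 < δ ∧ ∀ (j : ℕ) (y : 𝕋³), ‖y‖ ≤ δ →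
      ∫⁻ t in Ioo 0 τ, ∫⁻ x, ‖v j t (x - y) - v j t x‖ₑ ^ 3 ≤ Λ := by
    intro Λ hΛ
    rcases eq_or_ne Λ ⊤ with hΛt | hΛt
    · exact ⟨1, one_pos, fun j y _ => hΛt ▸ le_top⟩
    obtain ⟨δ, hδ, hδ'⟩ := hKR Λ.toReal (ENNReal.toReal_pos hΛ.ne' hΛt)
    refine ⟨δ, hδ, fun j y hy => ?_⟩
    have h := hδ' j 0 (-y) (by simpa using hδ.le) (by rwa [norm_neg])
    simpa only [add_zero, ← sub_eq_add_neg, ENNReal.ofReal_toReal hΛt] using h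
  -- Step 1 (H3, fed by H1/H2): a subsequence `φ₁` with Cauchy Fourier modes in `L³(0,τ)`
  obtain ⟨φ₁, hφ₁, hmodes⟩ :=
    exists_subseq_forall_modes_cauchy_L3_of_modulus hτ hsm hB hM hmodT
  -- Step 2 (H4): uniform mollification error from the SPACE modulus
  have hmoll : ∀ ρ : ℝ≥0∞, 0 < ρ → ∃ ε : ℝ, 0 < ε ∧ ε ≤ 1 / 4 ∧ ∀ n,
      ∫⁻ t in Ioo 0 τ, ∫⁻ x, ‖(kernel ε ⋆ v (φ₁ n) t) x - v (φ₁ n) t x‖ₑ ^ 3 ≤ ρ := by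
    intro ρ hρ
    obtain ⟨δ, hδ, hδ'⟩ := hmodX ρ hρ
    refine ⟨min δ (1 / 4), lt_min hδ (by norm_num), min_le_right _ _, fun n => ?_⟩
    exact lintegral_lintegral_kernel_convolution_sub_self_le
      (hsm' (φ₁ n)).aestronglyMeasurable_uncurry_prod
      (fun t ht => ((hsm' (φ₁ n)).isSmooth_slice ht).integrable)
      (lt_min hδ (by norm_num)) (min_le_right _ _)
      (fun y hy => hδ' (φ₁ n) y (hy.trans (min_le_left _ _)))
  -- Step 3 (H5): Cauchy in `L³((0,τ) × 𝕋³)` along `φ₁`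
  have hcau : ∀ η : ℝ≥0∞, 0 < η → ∃ N : ℕ, ∀ n m : ℕ, N ≤ n → N ≤ m →
      ∫⁻ t in Ioo 0 τ, ∫⁻ x, ‖v (φ₁ n) t x - v (φ₁ m) t x‖ₑ ^ 3 ≤ η := fun η hη =>
    exists_forall_lintegral_sub_pow_three_le_of_modes_of_mollify hτ (fun n => hsm' (φ₁ n)) hB
      (fun n => hM (φ₁ n)) hmoll hmodes hη
  -- Step 4 (H6): the strong limit `V` along a further subsequence `ψ`
  obtain ⟨ψ, V, hψ, hVm, hlim⟩ := exists_subseq_tendsto_of_cauchy_L3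
    (fun n => (hsm' (φ₁ n)).aestronglyMeasurable_uncurry_prod) hB (fun n => hM (φ₁ n)) hcau
  -- Step 5 (H7): periodise the representative
  obtain ⟨w, hwper, hwV, hwm⟩ := exists_periodic_extension hτ V hVm
  refine ⟨w, φ₁ ∘ ψ, hφ₁.comp hψ, hwper, hwm, ?_⟩
  have heq : ∀ n, ∫⁻ t in Ioo 0 τ, ∫⁻ x, ‖v ((φ₁ ∘ ψ) n) t x - w t x‖ₑ ^ 3 =
      ∫⁻ t in Ioo 0 τ, ∫⁻ x, ‖v (φ₁ (ψ n)) t x - V t x‖ₑ ^ 3 := fun n =>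
    setLIntegral_congr_fun measurableSet_Ioo fun t ht => by simp only [Function.comp_apply, hwV t ht]
  simp_rw [heq]
  exact hlim

/- Type-identity check (kept in the seat's folder copy, which imports `…Lines.tight`):
`theorem assembles_registered_stub : @stub_kolmogorovRieszPeriodicSlab = @stub_kolmogorovRieszPeriodicSlab_of_helpers := rfl`
elaborated on 2026-08-17 (lean check rc 0). -/

end Summit.AnomalousDissipation.AnomalousDissipation.Cruxes.EulerlimitThesisV2.Tight.Ideas3

end
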